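import Summits.ABC.ABC.Theorems.DeepRegimeABC.Negative.WithoutEps

/-!
# `DeepRegimeABC` (stmt-ABC-15121): every deep cell contains infinitely many abc hits

Negative-side support lemma for the crux `Summit.ABC.ABC.Theses.IneffectiveSubspace.DeepRegimeABC`,
from the crux disprover's work file `Cruxes/DeepRegimeABC/Disproof.lean` §(b) (2026-08-16):

* `deepCell_infinite_hits` — for every `K` the cell `{ω₅(abc) ≥ K}` contains INFINITELY many abc
  triples with `rad(abc) < c` (quality `> 1`).  This is Masser's `abc.S05` inside every deep cell
  (from `deepCell_no_uniform_constant`: the ratio `c/rad` is unbounded on the cell, so no finite set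
  of hits exhausts it).  Consequence for the crux: on no cell is `DeepRegimeABC` true for a trivial
  reason (finitely many exceptions to `c < rad`); its content on each cell is genuinely asymptotic,
  and the `ε`-dependence of the threshold (`Negative/UniformThreshold.lean`) is about an infinite
  family per cell, not about finitely many sporadic triples.
-/

-- `Summit.<Summit>.<Problem>` is the mandated summit-side namespace (CONVENTIONS §2); for the
-- single-conjunct summit `ABC` the two coincide, so the duplicate `ABC.ABC` is deliberate.
set_option linter.dupNamespace false

namespace Summit.ABC.ABC.Theorems.DeepRegimeABC.Negative

open Literature.NumberTheory.DiophantineGeometry UniqueFactorizationMonoid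

/-- **Every deep cell contains infinitely many abc hits** (`rad(abc) < c`, i.e. quality `> 1`).
[cite: GranvilleTucker2002, p. 1227] -/
theorem deepCell_infinite_hits (K : ℕ) :
    {t : ℕ × ℕ × ℕ | IsABCTriple t.1 t.2.1 t.2.2 ∧
      K ≤ ((t.1 * t.2.1 * t.2.2).primeFactors.filter
        (fun p => 5 ≤ (t.1 * t.2.1 * t.2.2).factorization p)).card ∧
      rad t.1 t.2.1 t.2.2 < t.2.2}.Infinite := by
  intro hfin
  set F := hfin.toFinset with hF
  -- a constant exceeding every `c` occurring in `F`
  set C : ℝ := (∑ t ∈ F, (t.2.2 : ℝ)) + 1 with hC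
  have hC1 : (1 : ℝ) ≤ C := by
    have : (0 : ℝ) ≤ ∑ t ∈ F, (t.2.2 : ℝ) := Finset.sum_nonneg fun t _ => Nat.cast_nonneg _
    linarith
  obtain ⟨a, b, c, habc, hK, hlt⟩ := deepCell_no_uniform_constant K C
  have hrad1 : (1 : ℝ) ≤ (rad a b c : ℝ) := by
    rw [rad_def]; exact_mod_cast Nat.radical_pos _
  -- it is a hit: rad ≤ C·rad < c
  have hhit : rad a b c < c := by
    have : (rad a b c : ℝ) < c := by nlinarith
    exact_mod_cast this
  have hmem : (a, b, c) ∈ F := by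
    rw [hF, Set.Finite.mem_toFinset]
    exact ⟨habc, hK, hhit⟩
  -- hence c ≤ Σ < C ≤ C·rad < c
  have hcle : (c : ℝ) ≤ ∑ t ∈ F, (t.2.2 : ℝ) :=
    Finset.single_le_sum (f := fun t : ℕ × ℕ × ℕ => (t.2.2 : ℝ)) (fun t _ => Nat.cast_nonneg _) hmem
  have : (c : ℝ) < c :=
    calc (c : ℝ) ≤ ∑ t ∈ F, (t.2.2 : ℝ) := hcle
      _ < C := by linarith
      _ ≤ C * (rad a b c : ℝ) := le_mul_of_one_le_right (by linarith) hrad1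
      _ < c := hlt
  exact lt_irrefl _ this

end Summit.ABC.ABC.Theorems.DeepRegimeABC.Negative
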